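import Literature.NumberTheory.LFunctions.WeilMellinBounds
import Mathlib.Analysis.Fourier.Inversion
import Mathlib.Analysis.Calculus.ParametricIntegral
import Mathlib.Analysis.SpecialFunctions.ImproperIntegrals
import Mathlib.MeasureTheory.Measure.Haar.NormedSpace
import Mathlib.MeasureTheory.Integral.Prod
import HarnessLib

/-!
# The Weil transform `ĝ` on vertical lines: holomorphy, decay, Mellin inversion

Sibling of `Literature/NumberTheory/LFunctions/WeilExplicit.lean` and `WeilMellinBounds.lean`
(normalisation `ĝ(s) = ∫ g(t) e^{(s - 1/2)t} dt`, `Literature.NumberTheory.LFunctions.weilMellin`). This file supplies the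
analytic facts about `ĝ` that the contour-integral proof of the Guinand–Weil explicit formula
(E. Bombieri, *Remarks on Weil's quadratic functional in the theory of prime numbers I*, Rend.
Mat. Acc. Lincei (9) 11 (2000), §2; there `f(x) = x^{-1/2} g(log x)` and `f̃ = ĝ`) uses on the
vertical lines `Re s = c`:

* `hasDerivAt_weilMellin`, `differentiable_weilMellin` — `ĝ` is entire for `g` continuous of
  compact support (differentiation under the integral sign);
* `norm_weilMellin_le_of_abs_re_le` — `‖ĝ(s)‖ ≤ C_{g,A}/(1 + (Im s)²)` on every vertical strip
  `|Re s - 1/2| ≤ A` (two integrations by parts, as in `norm_weilMellin_le` for the critical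
  strip; the constants `weilL1W A`, `weilDecayW A` specialise at `A = 1/2` to the strip constants
  `weilL1`, `weilDecayConst` of `WeilMellinBounds.lean`, `weilL1W_half`, `weilDecayW_half`),
  whence `integrable_weilMellin_vertical`: `y ↦ ĝ(c + iy)` is integrable;
* `weilMellin_inversion` — **Mellin inversion in additive form** ("the inverse Mellin transform
  formula", Bombieri §2 before (2.2)): `∫ ĝ(c + iy) e^{-(c - 1/2 + iy)t} dy = 2π g(t)` for every
  real `c` and every test function `g`; it is Mathlib's Fourier inversion theorem
  (`MeasureTheory.Integrable.fourierInv_fourier_eq`) for `t ↦ g(t) e^{(c-1/2)t}`, whose Fourier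
  transform is `w ↦ ĝ(c - 2πiw)` (`fourier_weilKernel`);
* consequences used term by term on the line `Re s = c` in §2 of Bombieri's paper:
  `integral_weilMellin_vertical` (`∫ ĝ(c+iy) dy = 2π g(0)`, the `log π` term),
  `integral_weilMellin_vertical_mul_natCast_cpow` (`∫ ĝ(c+iy) n^{-(c+iy)} dy = 2π n^{-1/2} g(log n)`,
  the prime terms), `integral_weilMellin_vertical_div_sub`
  (`∫ ĝ(c+iy)/(c+iy-a) dy = 2π ∫₀^∞ g(x) e^{(a-1/2)x} dx` for `Re a < c`, the polar terms, by
  `1/(s-a) = ∫₀^∞ e^{-(s-a)x} dx` and Fubini), and the bookkeeping identities `weilMellin_comp_neg`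
  (`(g(-·))^(s) = ĝ(1-s)`), `integral_Ioi_add_comp_neg_mul_eq` (folding `∫₀^∞` of `g(x) + g(-x)`
  against the even weight `e^{x/2} + e^{-x/2}` into `ĝ(0) + ĝ(1)`).

Everything here is proved; there are no named facts.

## References

* E. Bombieri, *Remarks on Weil's quadratic functional in the theory of prime numbers I*, Rend.
  Mat. Acc. Lincei (9) 11 (2000), 183–233, §2.
* H. Iwaniec, E. Kowalski, *Analytic Number Theory*, AMS Colloquium Publ. 53 (2004), §5.5
  (explicit formula), (5.44)–(5.45).
-/

noncomputable section

open Complex Filter Set MeasureTheory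
open scoped Real Topology FourierTransform

namespace Literature.NumberTheory.LFunctions

variable {g : ℝ → ℂ}

/-! ## `ĝ` is entire -/

/-- The `s`-derivative of the integrand `g(t) e^{(s-1/2)t}` of `ĝ(s)` is `g(t) t e^{(s-1/2)t}`.
[folklore] -/
theorem hasDerivAt_weilIntegrand (g : ℝ → ℂ) (t : ℝ) (s : ℂ) :
    HasDerivAt (fun s : ℂ ↦ g t * cexp ((s - 1 / 2) * t))
      (g t * (t * cexp ((s - 1 / 2) * t))) s := by
  have h1 : HasDerivAt (fun s : ℂ ↦ (s - 1 / 2) * t) (t : ℂ) s := by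
    simpa using ((hasDerivAt_id s).sub_const (1 / 2 : ℂ)).mul_const (t : ℂ)
  have h3 := (h1.cexp).const_mul (g t)
  exact h3.congr_deriv (by ring)

/-- **`ĝ` is entire**, with `ĝ'(s) = ∫ g(t) t e^{(s-1/2)t} dt`, for `g` continuous of compact
support (differentiation under the integral sign, dominated on the ball `‖s - s₀‖ < 1` by
`‖g(t)‖ |t| e^{(‖s₀‖+2)|t|}`). [folklore] -/
theorem hasDerivAt_weilMellin (hg : Continuous g) (hg' : HasCompactSupport g) (s₀ : ℂ) :
    HasDerivAt (weilMellin g) (∫ t : ℝ, g t * (t * cexp ((s₀ - 1 / 2) * t))) s₀ := by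
  set A : ℝ := ‖s₀‖ + 2 with hA
  have hF_meas : ∀ᶠ s in 𝓝 s₀,
      AEStronglyMeasurable (fun t : ℝ ↦ g t * cexp ((s - 1 / 2) * t)) volume :=
    Eventually.of_forall fun s ↦
      (by fun_prop : Continuous fun t : ℝ ↦ g t * cexp ((s - 1 / 2) * t)).aestronglyMeasurable
  have hF_int : Integrable (fun t : ℝ ↦ g t * cexp ((s₀ - 1 / 2) * t)) :=
    integrable_weilIntegrand hg hg' s₀
  have hF'_meas :
      AEStronglyMeasurable (fun t : ℝ ↦ g t * (t * cexp ((s₀ - 1 / 2) * t))) volume :=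
    (by fun_prop : Continuous fun t : ℝ ↦ g t * (t * cexp ((s₀ - 1 / 2) * t))).aestronglyMeasurable
  have h_bound : ∀ᵐ t : ℝ, ∀ s ∈ Metric.ball s₀ 1,
      ‖g t * (t * cexp ((s - 1 / 2) * t))‖ ≤ ‖g t‖ * (|t| * Real.exp (A * |t|)) := by
    refine Eventually.of_forall fun t s hs ↦ ?_
    rw [norm_mul, norm_mul, Complex.norm_exp, Complex.norm_real, Real.norm_eq_abs]
    refine mul_le_mul_of_nonneg_left (mul_le_mul_of_nonneg_left (Real.exp_le_exp.2 ?_)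
      (abs_nonneg _)) (norm_nonneg _)
    have hre : ((s - 1 / 2) * (t : ℂ)).re = (s.re - 1 / 2) * t := by simp [sub_re, mul_re]
    rw [hre]
    have hs' : ‖s - s₀‖ < 1 := by rwa [Metric.mem_ball, dist_eq_norm] at hs
    have h1 : |(s - s₀).re| ≤ ‖s - s₀‖ := abs_re_le_norm _
    have h2 : |s₀.re| ≤ ‖s₀‖ := abs_re_le_norm _
    have h3 : |s.re - 1 / 2| ≤ A := by
      have e : s.re - 1 / 2 = (s - s₀).re + s₀.re + (-(1 / 2)) := by simp; ring
      rw [e, hA]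
      refine (abs_add_three _ _ _).trans ?_
      rw [abs_neg, abs_of_pos (by norm_num : (0 : ℝ) < 1 / 2)]
      linarith
    calc (s.re - 1 / 2) * t ≤ |(s.re - 1 / 2) * t| := le_abs_self _
      _ = |s.re - 1 / 2| * |t| := abs_mul _ _
      _ ≤ A * |t| := mul_le_mul_of_nonneg_right h3 (abs_nonneg _)
  have bound_integrable : Integrable fun t : ℝ ↦ ‖g t‖ * (|t| * Real.exp (A * |t|)) :=
    (hg.norm.mul (by fun_prop)).integrable_of_hasCompactSupport hg'.norm.mul_right
  have h_diff : ∀ᵐ t : ℝ, ∀ s ∈ Metric.ball s₀ 1,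
      HasDerivAt (fun s : ℂ ↦ g t * cexp ((s - 1 / 2) * t))
        (g t * (t * cexp ((s - 1 / 2) * t))) s :=
    Eventually.of_forall fun t s _ ↦ hasDerivAt_weilIntegrand g t s
  have key := hasDerivAt_integral_of_dominated_loc_of_deriv_le (Metric.ball_mem_nhds s₀ one_pos)
    hF_meas hF_int hF'_meas h_bound bound_integrable h_diff
  exact key.2

/-- `ĝ` is an entire function for `g` continuous of compact support. [folklore] -/
theorem differentiable_weilMellin (hg : Continuous g) (hg' : HasCompactSupport g) :
    Differentiable ℂ (weilMellin g) :=
  fun s ↦ (hasDerivAt_weilMellin hg hg' s).differentiableAt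

/-- `ĝ` is continuous for `g` continuous of compact support. [folklore] -/
theorem continuous_weilMellin (hg : Continuous g) (hg' : HasCompactSupport g) :
    Continuous (weilMellin g) :=
  (differentiable_weilMellin hg hg').continuous

/-- `ĝ` is analytic at every point of any set (it is entire). [folklore] -/
theorem analyticOnNhd_weilMellin (hg : Continuous g) (hg' : HasCompactSupport g) (S : Set ℂ) :
    AnalyticOnNhd ℂ (weilMellin g) S :=
  fun s _ ↦ (differentiable_weilMellin hg hg').analyticAt s

/-! ## Decay of `ĝ` on vertical strips -/

/-- The weighted `L¹`-norm `∫ ‖g(t)‖ e^{A|t|} dt` controlling `ĝ` on the strip `|Re s - 1/2| ≤ A`.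
[folklore] -/
def weilL1W (A : ℝ) (g : ℝ → ℂ) : ℝ :=
  ∫ t : ℝ, ‖g t‖ * Real.exp (A * |t|)

/-- `weilL1W A g ≥ 0`. [folklore] -/
theorem weilL1W_nonneg (A : ℝ) (g : ℝ → ℂ) : 0 ≤ weilL1W A g :=
  integral_nonneg fun _ ↦ by positivity

/-- `weilL1W` generalises the strip constant `weilL1` of `WeilMellinBounds.lean`
(`A = 1/2`, the closed critical strip): `weilL1W (1/2) g = weilL1 g`. [folklore] -/
theorem weilL1W_half (g : ℝ → ℂ) : weilL1W (1 / 2) g = weilL1 g := by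
  unfold weilL1W weilL1
  congr 1 with t
  rw [mul_comm (1 / 2 : ℝ) |t|, ← div_eq_mul_one_div]

/-- On the strip `|Re s - 1/2| ≤ A`: `‖ĝ(s)‖ ≤ ∫ ‖g‖ e^{A|t|}` for continuous compactly supported
`g`. [folklore] -/
theorem norm_weilMellin_le_weilL1W (hg : Continuous g) (hg' : HasCompactSupport g) {A : ℝ}
    {s : ℂ} (hs : |s.re - 1 / 2| ≤ A) : ‖weilMellin g s‖ ≤ weilL1W A g := by
  unfold weilMellin weilL1W
  refine (norm_integral_le_integral_norm _).trans (integral_mono_of_nonneg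
    (Eventually.of_forall fun _ ↦ norm_nonneg _) ?_ (Eventually.of_forall fun t ↦ ?_))
  · exact (hg.norm.mul (by fun_prop)).integrable_of_hasCompactSupport hg'.norm.mul_right
  · simp only [norm_mul, Complex.norm_exp]
    refine mul_le_mul_of_nonneg_left (Real.exp_le_exp.2 ?_) (norm_nonneg _)
    have hre : ((s - 1 / 2) * (t : ℂ)).re = (s.re - 1 / 2) * t := by simp [sub_re, mul_re]
    rw [hre]
    calc (s.re - 1 / 2) * t ≤ |(s.re - 1 / 2) * t| := le_abs_self _
      _ = |s.re - 1 / 2| * |t| := abs_mul _ _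
      _ ≤ A * |t| := mul_le_mul_of_nonneg_right hs (abs_nonneg _)

/-- The decay constant `C_{g,A} = ∫ ‖g‖ e^{A|t|} + ∫ ‖g''‖ e^{A|t|}` of the strip
`|Re s - 1/2| ≤ A`. [folklore] -/
def weilDecayW (A : ℝ) (g : ℝ → ℂ) : ℝ :=
  weilL1W A g + weilL1W A (deriv (deriv g))

/-- `C_{g,A} ≥ 0`. [folklore] -/
theorem weilDecayW_nonneg (A : ℝ) (g : ℝ → ℂ) : 0 ≤ weilDecayW A g :=
  add_nonneg (weilL1W_nonneg _ _) (weilL1W_nonneg _ _)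

/-- `weilDecayW (1/2) g = weilDecayConst g` (the strip constant of `WeilMellinBounds.lean`).
[folklore] -/
theorem weilDecayW_half (g : ℝ → ℂ) : weilDecayW (1 / 2) g = weilDecayConst g := by
  rw [weilDecayW, weilDecayConst, weilL1W_half, weilL1W_half]

/-- **Decay of `ĝ` on vertical strips**: for a test function `g` and `|Re s - 1/2| ≤ A`,
`‖ĝ(s)‖ ≤ C_{g,A}/(1 + (Im s)²)` (two integrations by parts, `weilMellin_deriv_deriv`; Bombieri
§2: "`f̃` is rapidly decreasing on any vertical line"). [cite: Bombieri2000Weil, §2] -/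
theorem norm_weilMellin_le_of_abs_re_le (hg : IsWeilTest g) {A : ℝ} {s : ℂ}
    (hs : |s.re - 1 / 2| ≤ A) : ‖weilMellin g s‖ ≤ weilDecayW A g / (1 + s.im ^ 2) := by
  have hpos : 0 < 1 + s.im ^ 2 := by positivity
  rw [le_div_iff₀ hpos]
  have h1 : ‖weilMellin g s‖ ≤ weilL1W A g := norm_weilMellin_le_weilL1W hg.1.continuous hg.2 hs
  have h2 : ‖weilMellin (deriv (deriv g)) s‖ ≤ weilL1W A (deriv (deriv g)) :=
    norm_weilMellin_le_weilL1W hg.deriv.deriv.1.continuous hg.deriv.deriv.2 hs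
  rw [weilMellin_deriv_deriv hg, norm_mul, norm_pow] at h2
  have h3 : s.im ^ 2 ≤ ‖s - 1 / 2‖ ^ 2 := by
    have : |s.im| ≤ ‖s - 1 / 2‖ := by
      have h := Complex.abs_im_le_norm (s - 1 / 2)
      simpa using h
    nlinarith [abs_nonneg s.im, sq_abs s.im]
  unfold weilDecayW
  have h4 : 0 ≤ ‖weilMellin g s‖ := norm_nonneg _
  nlinarith

/-! ## `ĝ` on vertical lines -/

/-- `y ↦ ĝ(c + iy)` is continuous. [folklore] -/
theorem continuous_weilMellin_vertical (hg : Continuous g) (hg' : HasCompactSupport g) (c : ℝ) :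
    Continuous fun y : ℝ ↦ weilMellin g (c + y * I) :=
  (continuous_weilMellin hg hg').comp (by fun_prop)

/-- On the line `Re s = c`: `‖ĝ(c + iy)‖ ≤ C_{g,|c-1/2|} (1 + y²)⁻¹`. [folklore] -/
theorem norm_weilMellin_vertical_le (hg : IsWeilTest g) (c y : ℝ) :
    ‖weilMellin g (c + y * I)‖ ≤ weilDecayW |c - 1 / 2| g * (1 + y ^ 2)⁻¹ := by
  have h := norm_weilMellin_le_of_abs_re_le hg (A := |c - 1 / 2|) (s := c + y * I) (by simp)
  simpa [div_eq_mul_inv] using h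

/-- **`y ↦ ĝ(c + iy)` is integrable** on every vertical line, for every test function `g`
(from the decay `O(1/(1+y²))`). [folklore] -/
theorem integrable_weilMellin_vertical (hg : IsWeilTest g) (c : ℝ) :
    Integrable fun y : ℝ ↦ weilMellin g (c + y * I) :=
  Integrable.mono' (integrable_inv_one_add_sq.const_mul (weilDecayW |c - 1 / 2| g))
    (continuous_weilMellin_vertical hg.1.continuous hg.2 c).aestronglyMeasurable
    (Eventually.of_forall fun y ↦ norm_weilMellin_vertical_le hg c y)

/-- Integrability of `y ↦ ĝ(c + iy) F(y)` for a continuous bounded factor `F`. [folklore] -/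
theorem integrable_weilMellin_vertical_mul (hg : IsWeilTest g) (c : ℝ) {F : ℝ → ℂ}
    (hF : Continuous F) {B : ℝ} (hB : ∀ y, ‖F y‖ ≤ B) :
    Integrable fun y : ℝ ↦ weilMellin g (c + y * I) * F y :=
  (integrable_weilMellin_vertical hg c).mul_bdd hF.aestronglyMeasurable (Eventually.of_forall hB)

/-! ## Reflection `t ↦ -t` -/

/-- Test functions are stable under `t ↦ -t`. [folklore] -/
theorem IsWeilTest.comp_neg (hg : IsWeilTest g) : IsWeilTest fun t ↦ g (-t) :=
  ⟨hg.1.comp contDiff_neg, hg.2.comp_homeomorph (Homeomorph.neg ℝ)⟩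

/-- `(g(-·))^(s) = ĝ(1 - s)` (substitute `t ↦ -t`; no hypotheses). With `weilMellin_weilReflect`
this is Bombieri's `f̃*(s) = f̃(1 - s)`. [cite: Bombieri2000Weil, §2] -/
theorem weilMellin_comp_neg (g : ℝ → ℂ) (s : ℂ) :
    weilMellin (fun t ↦ g (-t)) s = weilMellin g (1 - s) := by
  unfold weilMellin
  have h := integral_neg_eq_self (fun t : ℝ ↦ g t * cexp ((1 - s - 1 / 2) * (t : ℂ))) volume
  rw [← h]
  congr 1 with t
  simp only [Complex.ofReal_neg]
  congr 2
  ring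

/-! ## Mellin inversion in additive form -/

/-- The Fourier transform of `t ↦ g(t) e^{(c-1/2)t}` is `w ↦ ĝ(c - 2πiw)` (Mathlib's
normalisation `𝓕 f(w) = ∫ e^{-2πi vw} f(v) dv`). [folklore] -/
theorem fourier_weilKernel (g : ℝ → ℂ) (c w : ℝ) :
    𝓕 (fun t : ℝ ↦ g t * cexp ((c - 1 / 2 : ℂ) * t)) w =
      weilMellin g (c + ((-(2 * π * w) : ℝ) : ℂ) * I) := by
  rw [Real.fourier_eq']
  unfold weilMellin
  congr 1 with t
  rw [Real.inner_apply, smul_eq_mul, mul_comm (cexp _) (g t * _), mul_assoc, ← Complex.exp_add]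
  congr 2
  push_cast
  ring

/-- **Mellin inversion for `ĝ`, additive form** (Bombieri §2, "the inverse Mellin transform
formula" `f(x) = (1/2πi) ∫_{(c)} f̃(w) x^{-w} dw`, with `x = e^t`, `f(x) = x^{-1/2} g(log x)`):
for a test function `g` and all real `c, t`,
`∫ ĝ(c + iy) e^{-iyt} dy = 2π g(t) e^{(c-1/2)t}`. (Fourier inversion,
`MeasureTheory.Integrable.fourierInv_fourier_eq`, for the continuous integrable function
`t ↦ g(t)e^{(c-1/2)t}` whose transform `w ↦ ĝ(c - 2πiw)` is integrable by
`integrable_weilMellin_vertical`.) [cite: Bombieri2000Weil, §2] -/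
theorem weilMellin_inversion (hg : IsWeilTest g) (c t : ℝ) :
    ∫ y : ℝ, weilMellin g (c + y * I) * cexp (-(y * I) * t) =
      2 * π * (g t * cexp ((c - 1 / 2 : ℂ) * t)) := by
  have hgc : Continuous g := hg.1.continuous
  set G : ℝ → ℂ := fun t ↦ g t * cexp ((c - 1 / 2 : ℂ) * t) with hG
  have hGc : Continuous G := by rw [hG]; fun_prop
  have hGi : Integrable G := hGc.integrable_of_hasCompactSupport hg.2.mul_right
  have hFG : 𝓕 G = fun w : ℝ ↦ weilMellin g (c + ((-(2 * π * w) : ℝ) : ℂ) * I) :=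
    funext (fourier_weilKernel g c)
  have hFGi : Integrable (𝓕 G) := by
    rw [hFG]
    have h := (integrable_weilMellin_vertical hg c).comp_mul_left' (R := -(2 * π))
      (neg_ne_zero.2 (by positivity))
    refine h.congr (Eventually.of_forall fun w ↦ ?_)
    simp only
    congr 3
    push_cast
    ring
  have hinv := hGi.fourierInv_fourier_eq hFGi (hGc.continuousAt (x := t))
  rw [Real.fourierInv_eq', hFG] at hinv
  simp only [Real.inner_apply, smul_eq_mul] at hinv
  -- substitute `y = -2π w`
  have hsub := Measure.integral_comp_mul_left
    (fun y : ℝ ↦ weilMellin g (c + y * I) * cexp (-(y * I) * t)) (-(2 * π))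
  have hH : (fun w : ℝ ↦ (fun y : ℝ ↦ weilMellin g (c + y * I) * cexp (-(y * I) * t))
      (-(2 * π) * w)) = fun w : ℝ ↦ cexp (((2 * π * (w * t) : ℝ) : ℂ) * I) *
        weilMellin g (c + ((-(2 * π * w) : ℝ) : ℂ) * I) := by
    funext w
    simp only
    rw [mul_comm]
    congr 1
    · congr 1
      push_cast
      ring
    · congr 1
      push_cast
      ring
  rw [hH, hinv] at hsub
  -- hsub : G t = |(-(2π))⁻¹| • ∫ y, ĝ(c+iy) e^{-iyt}
  have hpi : |(-(2 * π))⁻¹| = (2 * π)⁻¹ := by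
    rw [inv_neg, abs_neg, abs_of_pos (by positivity)]
  rw [hpi] at hsub
  have h2pi : (2 * π : ℝ) ≠ 0 := by positivity
  have key : (∫ y : ℝ, weilMellin g (c + y * I) * cexp (-(y * I) * t)) =
      ((2 * π : ℝ) : ℂ) * G t := by
    rw [hsub, Complex.real_smul, ← mul_assoc]
    push_cast
    rw [mul_inv_cancel₀ (mul_ne_zero two_ne_zero (Complex.ofReal_ne_zero.2 Real.pi_ne_zero)),
      one_mul]
  rw [key, hG]
  push_cast
  ring

/-- Mellin inversion, second form: `∫ ĝ(c + iy) e^{-(c - 1/2 + iy)t} dy = 2π g(t)`.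
[cite: Bombieri2000Weil, §2] -/
theorem weilMellin_inversion' (hg : IsWeilTest g) (c t : ℝ) :
    ∫ y : ℝ, weilMellin g (c + y * I) * cexp (-((c - 1 / 2 : ℂ) + y * I) * t) = 2 * π * g t := by
  have e : ∀ y : ℝ, weilMellin g (c + y * I) * cexp (-((c - 1 / 2 : ℂ) + y * I) * t) =
      weilMellin g (c + y * I) * cexp (-(y * I) * t) * cexp (-(c - 1 / 2 : ℂ) * t) := by
    intro y
    rw [mul_assoc, ← Complex.exp_add]
    congr 2
    ring
  simp_rw [e]
  rw [integral_mul_const, weilMellin_inversion hg c t]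
  have : (c - 1 / 2 : ℂ) * t + -(c - 1 / 2 : ℂ) * t = 0 := by ring
  calc 2 * (π : ℂ) * (g t * cexp ((c - 1 / 2 : ℂ) * t)) * cexp (-(c - 1 / 2 : ℂ) * t)
      = 2 * π * g t * (cexp ((c - 1 / 2 : ℂ) * t) * cexp (-(c - 1 / 2 : ℂ) * t)) := by ring
    _ = 2 * π * g t := by rw [← Complex.exp_add, this, Complex.exp_zero, mul_one]

/-- **The `log π` term of the explicit formula** (Bombieri (2.2): `(1/2πi)∫_{(c)} f̃(w) dw = f(1)`):
`∫ ĝ(c + iy) dy = 2π g(0)` for every test function `g` and real `c`.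
[cite: Bombieri2000Weil, §2 eq. (2.2)] -/
theorem integral_weilMellin_vertical (hg : IsWeilTest g) (c : ℝ) :
    ∫ y : ℝ, weilMellin g (c + y * I) = 2 * π * g 0 := by
  have h := weilMellin_inversion' hg c 0
  simpa using h

/-- **The prime terms of the explicit formula** (Bombieri (2.2):
`(1/2πi)∫_{(c)} f̃(w) n^{-w} dw = f(n) = n^{-1/2} g(log n)`): for a test function `g`, real `c`
and `n ≥ 1`, `∫ ĝ(c + iy) n^{-(c + iy)} dy = 2π g(log n)/√n`. [cite: Bombieri2000Weil, §2 eq. (2.2)] -/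
theorem integral_weilMellin_vertical_mul_natCast_cpow (hg : IsWeilTest g) (c : ℝ) {n : ℕ}
    (hn : n ≠ 0) :
    ∫ y : ℝ, weilMellin g (c + y * I) * (n : ℂ) ^ (-(c + y * I : ℂ)) =
      2 * π * (g (Real.log n) / (Real.sqrt n : ℂ)) := by
  have hn0 : (0 : ℝ) < n := by exact_mod_cast Nat.pos_of_ne_zero hn
  have hnC : (n : ℂ) ≠ 0 := by exact_mod_cast hn
  set L : ℝ := Real.log n with hL
  have hlog : Complex.log (n : ℂ) = (L : ℂ) := by
    rw [hL, ← Complex.ofReal_natCast, ← Complex.ofReal_log hn0.le]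
  have hsqrt : (Real.sqrt n : ℂ) = cexp ((L : ℂ) / 2) := by
    rw [hL, ← Complex.ofReal_ofNat, ← Complex.ofReal_div, ← Complex.ofReal_exp, Real.exp_half,
      Real.exp_log hn0]
  have hsqrt0 : (Real.sqrt n : ℂ) ≠ 0 := by rw [hsqrt]; exact Complex.exp_ne_zero _
  have e : ∀ y : ℝ, weilMellin g (c + y * I) * (n : ℂ) ^ (-(c + y * I : ℂ)) =
      weilMellin g (c + y * I) * cexp (-((c - 1 / 2 : ℂ) + y * I) * L) * (Real.sqrt n : ℂ)⁻¹ := by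
    intro y
    rw [Complex.cpow_def_of_ne_zero hnC, hlog, hsqrt, ← Complex.exp_neg, mul_assoc,
      ← Complex.exp_add]
    congr 2
    ring
  simp_rw [e]
  rw [integral_mul_const, weilMellin_inversion' hg c L, div_eq_mul_inv]
  ring

/-- **The polar terms of the explicit formula**: for a test function `g`, a real `c` and
`Re a < c`, `∫ ĝ(c + iy)/(c + iy - a) dy = 2π ∫₀^∞ g(x) e^{(a - 1/2)x} dx`
(`1/(s - a) = ∫₀^∞ e^{-(s-a)x} dx`, Fubini, and Mellin inversion; with `a = 0, 1` these are the
residues `f̃(0)`, `f̃(1)` of Bombieri (2.3) recovered on the line `Re s = c`).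
[cite: Bombieri2000Weil, §2 eq. (2.3)] -/
theorem integral_weilMellin_vertical_div_sub (hg : IsWeilTest g) {c : ℝ} {a : ℂ}
    (hac : a.re < c) :
    ∫ y : ℝ, weilMellin g (c + y * I) / (c + y * I - a) =
      2 * π * ∫ x in Ioi (0 : ℝ), g x * cexp ((a - 1 / 2) * x) := by
  have hgc : Continuous g := hg.1.continuous
  have hcont : Continuous (weilMellin g) := continuous_weilMellin hgc hg.2
  -- Step 1: `1/(s - a) = ∫₀^∞ e^{(a - s)x} dx` on the line.
  have hrep : ∀ y : ℝ, (c + y * I - a)⁻¹ =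
      ∫ x in Ioi (0 : ℝ), cexp ((a - (c + y * I)) * x) := by
    intro y
    have hre : (a - (c + y * I)).re < 0 := by simp; linarith
    rw [integral_exp_mul_complex_Ioi hre 0]
    simp only [Complex.ofReal_zero, mul_zero, Complex.exp_zero]
    rw [neg_div, ← div_neg, one_div, neg_sub]
  have step1 : (fun y : ℝ ↦ weilMellin g (c + y * I) / (c + y * I - a)) =
      fun y : ℝ ↦ ∫ x in Ioi (0 : ℝ), weilMellin g (c + y * I) * cexp ((a - (c + y * I)) * x) := by
    funext y
    rw [div_eq_mul_inv, hrep y, ← integral_const_mul]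
  rw [step1]
  -- Step 2: Fubini.
  have hint : Integrable (Function.uncurry fun (y : ℝ) (x : ℝ) ↦
      weilMellin g (c + y * I) * cexp ((a - (c + y * I)) * x))
      ((volume : Measure ℝ).prod (volume.restrict (Ioi (0 : ℝ)))) := by
    have h1 : Integrable (fun y : ℝ ↦ weilMellin g (c + y * I)) := integrable_weilMellin_vertical hg c
    have h2 : Integrable (fun x : ℝ ↦ cexp ((a - c) * x)) (volume.restrict (Ioi (0 : ℝ))) :=
      integrableOn_exp_mul_complex_Ioi (by simp; linarith) 0
    refine Integrable.mono' (h1.mul_prod h2).norm ?_ (Eventually.of_forall fun p ↦ ?_)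
    · exact (by fun_prop : Continuous (Function.uncurry fun (y : ℝ) (x : ℝ) ↦
        weilMellin g (c + y * I) * cexp ((a - (c + y * I)) * x))).aestronglyMeasurable
    · obtain ⟨y, x⟩ := p
      simp only [Function.uncurry_apply_pair, norm_mul, Complex.norm_exp]
      refine le_of_eq ?_
      congr 2
      simp [sub_re, mul_re]
  rw [integral_integral_swap hint]
  -- Step 3: inner integral by Mellin inversion.
  have inner : ∀ x : ℝ, (∫ y : ℝ, weilMellin g (c + y * I) * cexp ((a - (c + y * I)) * x)) =
      cexp ((a - 1 / 2) * x) * (2 * π * g x) := by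
    intro x
    rw [← weilMellin_inversion' hg c x, ← integral_const_mul]
    congr 1 with y
    rw [mul_left_comm, ← Complex.exp_add]
    congr 2
    ring
  simp_rw [inner]
  rw [← integral_const_mul]
  congr 1 with x
  ring

/-! ## Folding `∫₀^∞` of `g(x) + g(-x)` -/

/-- For an even weight `w` (`w(-x) = w(x)`) and `g` with `g·w` integrable,
`∫₀^∞ (g(x) + g(-x)) w(x) dx = ∫ g(x) w(x) dx`. [folklore] -/
theorem integral_Ioi_add_comp_neg_mul_eq {w : ℝ → ℂ} (hw : ∀ x, w (-x) = w x)
    (hgw : Integrable fun x : ℝ ↦ g x * w x) :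
    ∫ x in Ioi (0 : ℝ), (g x + g (-x)) * w x = ∫ x : ℝ, g x * w x := by
  have h1 : IntegrableOn (fun x : ℝ ↦ g x * w x) (Ioi 0) := hgw.integrableOn
  have h2 : IntegrableOn (fun x : ℝ ↦ g x * w x) (Iic 0) := hgw.integrableOn
  have h3 : IntegrableOn (fun x : ℝ ↦ g (-x) * w x) (Ioi 0) := by
    have e : (fun x : ℝ ↦ g (-x) * w x) = fun x : ℝ ↦ (fun u : ℝ ↦ g u * w u) (-x) := by
      funext x; simp [hw]
    rw [e]
    have := hgw.comp_neg
    exact this.integrableOn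
  have hsplit : (fun x : ℝ ↦ (g x + g (-x)) * w x) =
      fun x : ℝ ↦ g x * w x + g (-x) * w x := by funext x; ring
  rw [hsplit, integral_add h1 h3]
  have hneg : ∫ x in Ioi (0 : ℝ), g (-x) * w x = ∫ x in Iic (0 : ℝ), g x * w x := by
    have := integral_comp_neg_Ioi 0 (fun u : ℝ ↦ g u * w u)
    simp only [neg_zero] at this
    rw [← this]
    congr 1 with x
    simp [hw]
  rw [hneg, add_comm, intervalIntegral.integral_Iic_add_Ioi h2 h1]

/-- **The polar weight is even and produces `ĝ(0) + ĝ(1)`**: for a test function `g`,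
`∫₀^∞ (g(x) + g(-x)) (e^{-x/2} + e^{x/2}) dx = ĝ(0) + ĝ(1)`. [folklore] -/
theorem integral_Ioi_add_comp_neg_mul_polarWeight (hg : IsWeilTest g) :
    ∫ x in Ioi (0 : ℝ), (g x + g (-x)) * (cexp (-(x : ℂ) / 2) + cexp ((x : ℂ) / 2)) =
      weilMellin g 0 + weilMellin g 1 := by
  have hgc : Continuous g := hg.1.continuous
  have hgw : Integrable fun x : ℝ ↦ g x * (cexp (-(x : ℂ) / 2) + cexp ((x : ℂ) / 2)) :=
    (hgc.mul (by fun_prop)).integrable_of_hasCompactSupport hg.2.mul_right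
  rw [integral_Ioi_add_comp_neg_mul_eq (fun x ↦ by push_cast; ring_nf)
    hgw]
  unfold weilMellin
  rw [← integral_add (integrable_weilIntegrand hgc hg.2 0) (integrable_weilIntegrand hgc hg.2 1)]
  congr 1 with x
  have e1 : ((0 : ℂ) - 1 / 2) * x = -(x : ℂ) / 2 := by ring
  have e2 : ((1 : ℂ) - 1 / 2) * x = (x : ℂ) / 2 := by ring
  rw [e1, e2]
  ring

end Literature.NumberTheory.LFunctions

end
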